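import Literature.Geometry.Lorentzian.KerrDeSitterSurfaceGravities
import HarnessLib

/-!
# Casals–Teixeira da Costa 2022, Theorem 3.10 with its standing hypothesis `ω ≠ 0`
# (the corrected vendoring of `CasalsTeixeiraDaCosta2022_partialModeStability`) — named fact

Source read verbatim: M. Casals, R. Teixeira da Costa, *Hidden spectral symmetries and mode stability
of subextremal Kerr(-de Sitter) black holes*, Commun. Math. Phys. 394 (2022) 797–832
[CasalsTeixeiradacosta2022], arXiv:2105.13329 (v3 wording of Theorem 3.10 / Definition 3.3; held
text = v1, pages cited below): Definition 3.4 (p. 14, l. 11 of the held text): "Fix `M > 0`, `L > 0`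
and `|a| < L` satisfying (3.1). Take `s ∈ ½ℤ`, `m − s ∈ ℤ` and **`ω ∈ ℂ∖{0}`** with `Im ω ≥ 0`."; the
introduction's Theorem 1 (p. 4, l. 23): "no non-trivial mode solutions … **for `ω ≠ 0`** with
`Im ω ≥ 0`"; Theorem 3.10 (verbatim in `KerrDeSitterPartialModeStability.lean`).

## Why this file exists (pub-kds audit `H1H3-AS-PRINTED.md`, delta D-ω0)

The landed named fact `CasalsTeixeiraDaCosta2022_partialModeStability` renders Theorem 3.10's two
bullets but OMITS the standing hypothesis `ω ≠ 0` of §3.2 (Definition 3.4). Its real-axis disjunct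
(`ω.im = 0 ∧ …`, with the sub-case `m = 0`) therefore also speaks about `ω = 0`, where the printed
theorem says nothing (its Wronskian identity "`0 = ω(ω−mϖ₁)|u(−∞)|² + ω(ω−mϖ₂)|u(+∞)|²`", p. 17, is
void at `ω = 0`) — and where the typed statement is refutable: for `s = 0`, `m = 0`, `ω = 0` and real
`λ` both boundary exponents vanish (`radialK a 0 0 = 0`, so `horizonB = 0`), "ingoing/outgoing" reduce
to "`R` agrees with a `C^∞` function at the horizon", and the radial equation is the Legendre-type
singular Sturm–Liouville problem `(Δ_r R')' = ((2Λ/3)r² + λ)R` on `(r₊, r_c)`, which has infinitely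
many real eigenvalues `λ_n ↓ −∞` with eigenfunctions analytic on a neighbourhood of `[r₊, r_c]`
(float screen at `(M,a,Λ) = (1, 1/2, 1/50)`: `λ ≈ −0.520, −1.716, −4.097, …`); for these the typed
fact asserts `R ≡ 0`. So the landed def is a false proposition and any theorem binding it as a
hypothesis is vacuous as a conditional. Per the tree's rule for mis-stated facts the landed def is
NOT edited; this file vendors the corrected statement under a NEW name and threads the two
consequences box certificates use.

## What is vendored (and how)

ONE named fact `CasalsTeixeiraDaCosta2022_theorem310`: literally the landed text of
`CasalsTeixeiraDaCosta2022_partialModeStability` (same hypotheses, same vocabulary — `IsSubextremal`,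
`0 ≤ a`, `|a| < 3/Λ` and `a² < 3/Λ`, `2s ∈ ℤ`, `m − s ∈ ℤ`, the two bullets, the generic-boundary
regime `(Re ω ≠ mϖ₁ ∨ s ≤ 0) ∧ (Re ω ≠ mϖ₂ ∨ 0 ≤ s)`, conclusion `R ≡ 0` on `(r₊, r_c)`) with the
printed standing hypothesis **`ω ≠ 0`** inserted after the integrality hypotheses (Definition 3.4
verbatim). Everything else in this file is proved:
* `CasalsTeixeiraDaCosta2022_partialModeStability.theorem310`: the landed fact implies the corrected
  one (it asserts more), so nothing proved from the old binder is lost;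
* `.window` (bullet 1: a non-trivial generic-regime solution with `Im ω > 0`, `Im(λ̄ω̄) ≤ 0` has
  `0 < |ω| < |m|Ω_SR` — the SAME statement as the landed `….partialModeStability.window`, so every
  `Im ω > 0` consumer ports by renaming the binder) and `.realAxis` (bullet 2, now with `ω ≠ 0`);
* the identification of the tree's horizon exponents with the paper's `η_j` used in Definition 3.3
  — `horizonB(r₊) = −η₁`, `horizonB(r_c) = −η₂` on subextremal parameters (`K(r_j) =
  (ω − mϖ_j)(r_j² + a²)`, `κ_j = |Δ_r'(r_j)|/(2Ξ(r_j²+a²))`, `Δ_r'(r₊) > 0 > Δ_r'(r_c)`) — which the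
  docstrings of `IsIngoingAtEventHorizon` / `IsOutgoingAtCosmoHorizon` state in words
  (`horizonB_rPlus_eq_neg_etaEvent`, `horizonB_rCosmo_eq_neg_etaCosmo`).
No other facts. -- TODO(general form): the threshold-ray cases of Thm 3.10/Cor 3.9 (as for the landed fact).
-/

noncomputable section

open Complex Set

namespace Literature.Geometry.Lorentzian.KerrDeSitter

/-! ### The corrected named fact -/

/-- **Casals–Teixeira da Costa 2022, Theorem 3.10 (partial mode stability of the Teukolsky equation
on subextremal Kerr–de Sitter), generic-boundary regime, with the standing hypothesis `ω ≠ 0` of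
Definition 3.4.** As printed (arXiv v3; CMP 394 (2022) 797–832): "[§3.2, Def. 3.4] Fix `M > 0`,
`L > 0` and `|a| < L` satisfying (3.1). Take `s ∈ ½ℤ`, `m − s ∈ ℤ` and `ω ∈ ℂ∖{0}` with `Im ω ≥ 0`. …
[Thm. 3.10] Fix `M > 0`, `|a| < 3/Λ` and `Λ > 0` satisfying (3.1), `s ∈ ½ℤ`, `m − s ∈ ℤ` and `(ω, λ̄)`
such that one of the following holds: • `Im ω > 0`, `Im(λ̄ ω̄) ≤ 0` and
`|ω| ∉ |m|(0, (ϖ₂/κ₂+ϖ₀/κ₀)/(1/κ₂+1/κ₀))`; • `ω ∈ ℝ`, `λ̄ ∈ ℝ` and, if `|s| ≠ ½, 3/2`, additionally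
`m = 0` or `ω/m ∉ ((ϖ₁/κ₁−ϖ₀/κ₀)/(1/κ₁−1/κ₀), (ϖ₂/κ₂+ϖ₀/κ₀)/(1/κ₂+1/κ₀))`. If `α(r)` is a solution to
(3.9) with respect to these parameters which is ingoing at `𝓗⁺` and outgoing at `𝓗⁺_c`, then
`α ≡ 0`." RENDERED exactly as the landed `CasalsTeixeiraDaCosta2022_partialModeStability` (tree's
`IsSubextremal`; `0 ≤ a`, the case `a < 0` being the image under `(a, m) ↦ (−a, −m)`
(`KerrDeSitterRotationReversal`); both `|a| < 3/Λ` as printed and the intended `a² < 3/Λ`; thresholds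
in the closed form `2a/(a²+3/Λ−(r₀+r_j)²)` of Theorem 2; `λ̄ = lambdaBar λ`; ONLY the regime where
Definition 3.3 uses the generic exponents, `(Re ω ≠ mϖ₁ ∨ s ≤ 0)` and `(Re ω ≠ mϖ₂ ∨ 0 ≤ s)`, in
which "ingoing/outgoing" are `IsIngoingAtEventHorizon`/`IsOutgoingAtCosmoHorizon`) PLUS the printed
`ω ≠ 0`, whose omission made the landed def refutable at `(s, ω, m) = (0, 0, 0)` (module docstring).
Named fact; users take `(h : CasalsTeixeiraDaCosta2022_theorem310)`.
[cite: CasalsTeixeiradacosta2022, Theorem 3.10 with Definition 3.4] -/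
def CasalsTeixeiraDaCosta2022_theorem310 : Prop :=
  ∀ (M a Λ s : ℝ) (ω : ℂ) (m : ℝ) (lam : ℂ), IsSubextremal M a Λ → 0 ≤ a → |a| < 3 / Λ →
    a ^ 2 < 3 / Λ →
    (∃ k : ℤ, 2 * s = k) → (∃ k : ℤ, m - s = k) → ω ≠ 0 →
    ((0 < ω.im ∧ (lambdaBar a Λ s ω m lam * (starRingEnd ℂ) ω).im ≤ 0 ∧
        ¬(0 < ‖ω‖ ∧ ‖ω‖ < |m| * superradiantUpper M a Λ)) ∨
      (ω.im = 0 ∧ (lambdaBar a Λ s ω m lam).im = 0 ∧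
        ((∃ k : ℤ, 2 * |s| = k ∧ (k = 1 ∨ k = 3)) ∨ m = 0 ∨
          ¬(superradiantLower M a Λ < ω.re / m ∧ ω.re / m < superradiantUpper M a Λ)))) →
    (ω.re ≠ m * horizonAngVel a (rPlus M a Λ) ∨ s ≤ 0) →
    (ω.re ≠ m * horizonAngVel a (rCosmo M a Λ) ∨ 0 ≤ s) →
    ∀ R : ℝ → ℂ, IsRadialTeukolskySolution M a Λ s ω m lam R →
      IsIngoingAtEventHorizon M a Λ s ω m R → IsOutgoingAtCosmoHorizon M a Λ ω m R →
        ∀ r ∈ Ioo (rPlus M a Λ) (rCosmo M a Λ), R r = 0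

/-- The landed (mis-stated, `ω = 0` included) fact implies the corrected one — it asserts more.
[cite: CasalsTeixeiradacosta2022, Theorem 3.10 with Definition 3.4] -/
theorem CasalsTeixeiraDaCosta2022_partialModeStability.theorem310
    (h : CasalsTeixeiraDaCosta2022_partialModeStability) : CasalsTeixeiraDaCosta2022_theorem310 :=
  fun M a Λ s ω m lam hsub ha haL haL2 hs hm _ hb h1 h2 R hR hin hout r hr =>
    h M a Λ s ω m lam hsub ha haL haL2 hs hm hb h1 h2 R hR hin hout r hr

/-! ### The two consequences box certificates use -/

/-- **Bullet 1 (upper half-plane), finite reduction in `ω`.** In the generic-boundary regime a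
non-trivial Kerr–de Sitter Teukolsky radial solution, ingoing at `𝓗⁺` and outgoing at `𝓗⁺_c`, with
`Im ω > 0` and `Im(λ̄ ω̄) ≤ 0` has `0 < |ω| < |m|·Ω_SR`. Same statement as the landed
`CasalsTeixeiraDaCosta2022_partialModeStability.window` (here `ω ≠ 0` follows from `Im ω > 0`).
[cite: CasalsTeixeiradacosta2022, Theorem 3.10] -/
theorem CasalsTeixeiraDaCosta2022_theorem310.window
    (h : CasalsTeixeiraDaCosta2022_theorem310) {M a Λ s : ℝ} {ω : ℂ} {m : ℝ} {lam : ℂ}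
    (hsub : IsSubextremal M a Λ) (ha : 0 ≤ a) (haL : |a| < 3 / Λ) (haL2 : a ^ 2 < 3 / Λ)
    (hs : ∃ k : ℤ, 2 * s = k)
    (hm : ∃ k : ℤ, m - s = k) (hω : 0 < ω.im)
    (hlam : (lambdaBar a Λ s ω m lam * (starRingEnd ℂ) ω).im ≤ 0)
    (h1 : ω.re ≠ m * horizonAngVel a (rPlus M a Λ) ∨ s ≤ 0)
    (h2 : ω.re ≠ m * horizonAngVel a (rCosmo M a Λ) ∨ 0 ≤ s) {R : ℝ → ℂ}
    (hR : IsRadialTeukolskySolution M a Λ s ω m lam R) (hin : IsIngoingAtEventHorizon M a Λ s ω m R)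
    (hout : IsOutgoingAtCosmoHorizon M a Λ ω m R) (hnt : ∃ r ∈ Ioo (rPlus M a Λ) (rCosmo M a Λ), R r ≠ 0) :
    0 < ‖ω‖ ∧ ‖ω‖ < |m| * superradiantUpper M a Λ := by
  have hω0 : ω ≠ 0 := by
    rintro rfl
    simp at hω
  by_contra hw
  obtain ⟨r, hr, hne⟩ := hnt
  exact hne (h M a Λ s ω m lam hsub ha haL haL2 hs hm hω0 (Or.inl ⟨hω, hlam, hw⟩) h1 h2 R hR hin hout
    r hr)

/-- **Bullet 2 (real axis, `ω ≠ 0`).** In the generic-boundary regime, for real `ω ≠ 0` and real `λ̄`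
with `|s| ∈ {½, 3/2}`, or `m = 0`, or `ω/m ∉ (Ω_low, Ω_SR)`, every Kerr–de Sitter Teukolsky radial
solution ingoing at `𝓗⁺` and outgoing at `𝓗⁺_c` vanishes on `(r₊, r_c)`.
[cite: CasalsTeixeiradacosta2022, Theorem 3.10 with Definition 3.4] -/
theorem CasalsTeixeiraDaCosta2022_theorem310.realAxis
    (h : CasalsTeixeiraDaCosta2022_theorem310) {M a Λ s : ℝ} {ω : ℂ} {m : ℝ} {lam : ℂ}
    (hsub : IsSubextremal M a Λ) (ha : 0 ≤ a) (haL : |a| < 3 / Λ) (haL2 : a ^ 2 < 3 / Λ)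
    (hs : ∃ k : ℤ, 2 * s = k) (hm : ∃ k : ℤ, m - s = k) (hω0 : ω ≠ 0) (hreal : ω.im = 0)
    (hlam : (lambdaBar a Λ s ω m lam).im = 0)
    (hsr : (∃ k : ℤ, 2 * |s| = k ∧ (k = 1 ∨ k = 3)) ∨ m = 0 ∨
      ¬(superradiantLower M a Λ < ω.re / m ∧ ω.re / m < superradiantUpper M a Λ))
    (h1 : ω.re ≠ m * horizonAngVel a (rPlus M a Λ) ∨ s ≤ 0)
    (h2 : ω.re ≠ m * horizonAngVel a (rCosmo M a Λ) ∨ 0 ≤ s) {R : ℝ → ℂ}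
    (hR : IsRadialTeukolskySolution M a Λ s ω m lam R) (hin : IsIngoingAtEventHorizon M a Λ s ω m R)
    (hout : IsOutgoingAtCosmoHorizon M a Λ ω m R) :
    ∀ r ∈ Ioo (rPlus M a Λ) (rCosmo M a Λ), R r = 0 :=
  h M a Λ s ω m lam hsub ha haL haL2 hs hm hω0 (Or.inr ⟨hreal, hlam, hsr⟩) h1 h2 R hR hin hout

/-- A non-trivial solution in the situation of `.realAxis` contradicts the fact (the form used when a
mode is given by `∃ r, R r ≠ 0`). [cite: CasalsTeixeiradacosta2022, Theorem 3.10 with Definition 3.4] -/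
theorem CasalsTeixeiraDaCosta2022_theorem310.realAxis_absurd
    (h : CasalsTeixeiraDaCosta2022_theorem310) {M a Λ s : ℝ} {ω : ℂ} {m : ℝ} {lam : ℂ}
    (hsub : IsSubextremal M a Λ) (ha : 0 ≤ a) (haL : |a| < 3 / Λ) (haL2 : a ^ 2 < 3 / Λ)
    (hs : ∃ k : ℤ, 2 * s = k) (hm : ∃ k : ℤ, m - s = k) (hω0 : ω ≠ 0) (hreal : ω.im = 0)
    (hlam : (lambdaBar a Λ s ω m lam).im = 0)
    (hsr : (∃ k : ℤ, 2 * |s| = k ∧ (k = 1 ∨ k = 3)) ∨ m = 0 ∨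
      ¬(superradiantLower M a Λ < ω.re / m ∧ ω.re / m < superradiantUpper M a Λ))
    (h1 : ω.re ≠ m * horizonAngVel a (rPlus M a Λ) ∨ s ≤ 0)
    (h2 : ω.re ≠ m * horizonAngVel a (rCosmo M a Λ) ∨ 0 ≤ s) {R : ℝ → ℂ}
    (hR : IsRadialTeukolskySolution M a Λ s ω m lam R) (hin : IsIngoingAtEventHorizon M a Λ s ω m R)
    (hout : IsOutgoingAtCosmoHorizon M a Λ ω m R)
    (hnt : ∃ r ∈ Ioo (rPlus M a Λ) (rCosmo M a Λ), R r ≠ 0) : False := by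
  obtain ⟨r, hr, hne⟩ := hnt
  exact hne (h.realAxis hsub ha haL haL2 hs hm hω0 hreal hlam hsr h1 h2 hR hin hout r hr)

/-! ### The tree's horizon exponents are the paper's `−η_j` (Definition 3.3 ⇔ the tree's boundary conditions) -/

/-- **`B(r₊) = −η₁`** on subextremal Kerr–de Sitter: `iΞK(r₊)/Δ_r'(r₊) = i(ω − mϖ₁)/(2κ₁)` because
`K(r₊) = (ω − mϖ₁)(r₊² + a²)`, `κ₁ = Δ_r'(r₊)/(2Ξ(r₊² + a²))` and `Δ_r'(r₊) > 0`. This is the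
identification under which Definition 3.3's first bullet "`R(r)(r−r₁)^{−η₁+(s−1)/2}` smooth"
(`R = (r−r₃)Δ^{(s+1)/2}ᾱ`) is `IsIngoingAtEventHorizon` ("`ᾱ(r−r₊)^{s+B(r₊)}` smooth").
[cite: CasalsTeixeiradacosta2022, (3.10) and Definition 3.3] -/
theorem horizonB_rPlus_eq_neg_etaEvent {M a Λ : ℝ} (hsub : IsSubextremal M a Λ) (ω : ℂ) (m : ℝ) :
    horizonB M a Λ ω m (rPlus M a Λ) = -etaEvent M a Λ ω m := by
  have hd := deltaDeriv_rPlus_pos hsub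
  obtain ⟨hM, hΛ, h01, h12, -⟩ := hsub
  have hr : 0 < rPlus M a Λ := lt_of_le_of_lt (rMinus_nonneg M a Λ) h01
  have hξ := xi_pos hΛ.le a
  have hra : rPlus M a Λ ^ 2 + a ^ 2 ≠ 0 := by positivity
  have hκ : surfaceGravity M a Λ (rPlus M a Λ) =
      deltaDeriv M a Λ (rPlus M a Λ) / (2 * xi a Λ * (rPlus M a Λ ^ 2 + a ^ 2)) := by
    unfold surfaceGravity
    rw [abs_of_pos hd]
  unfold horizonB etaEvent etaOf horizonAngVel radialK
  rw [hκ]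
  have hd' : (deltaDeriv M a Λ (rPlus M a Λ) : ℂ) ≠ 0 := by exact_mod_cast hd.ne'
  have hξ' : (xi a Λ : ℂ) ≠ 0 := by exact_mod_cast hξ.ne'
  have hra' : ((rPlus M a Λ : ℂ) ^ 2 + (a : ℂ) ^ 2) ≠ 0 := by exact_mod_cast hra
  push_cast
  field_simp

/-- **`B(r_c) = −η₂`** on subextremal Kerr–de Sitter: `iΞK(r_c)/Δ_r'(r_c) = −i(ω − mϖ₂)/(2κ₂)`
because `κ₂ = −Δ_r'(r_c)/(2Ξ(r_c² + a²))` with `Δ_r'(r_c) < 0`. Under it Definition 3.3's bullet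
"`R(r)(r−r₂)^{η₂−(s+1)/2}` smooth" is `IsOutgoingAtCosmoHorizon` ("`ᾱ(r_c−r)^{−B(r_c)}` smooth").
[cite: CasalsTeixeiradacosta2022, (3.10) and Definition 3.3] -/
theorem horizonB_rCosmo_eq_neg_etaCosmo {M a Λ : ℝ} (hsub : IsSubextremal M a Λ) (ω : ℂ) (m : ℝ) :
    horizonB M a Λ ω m (rCosmo M a Λ) = -etaCosmo M a Λ ω m := by
  have hd := deltaDeriv_rCosmo_neg hsub
  obtain ⟨hM, hΛ, h01, h12, -⟩ := hsub
  have hr : 0 < rCosmo M a Λ := (lt_of_le_of_lt (rMinus_nonneg M a Λ) h01).trans h12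
  have hξ := xi_pos hΛ.le a
  have hra : rCosmo M a Λ ^ 2 + a ^ 2 ≠ 0 := by positivity
  have hκ : surfaceGravity M a Λ (rCosmo M a Λ) =
      -deltaDeriv M a Λ (rCosmo M a Λ) / (2 * xi a Λ * (rCosmo M a Λ ^ 2 + a ^ 2)) := by
    unfold surfaceGravity
    rw [abs_of_neg hd]
  unfold horizonB etaCosmo etaOf horizonAngVel radialK
  rw [hκ]
  have hd' : (deltaDeriv M a Λ (rCosmo M a Λ) : ℂ) ≠ 0 := by exact_mod_cast hd.ne
  have hξ' : (xi a Λ : ℂ) ≠ 0 := by exact_mod_cast hξ.ne'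
  have hra' : ((rCosmo M a Λ : ℂ) ^ 2 + (a : ℂ) ^ 2) ≠ 0 := by exact_mod_cast hra
  push_cast
  field_simp

end Literature.Geometry.Lorentzian.KerrDeSitter

end
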